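import Mathlib
import Literature.Analysis.Matrix.HadamardInequality

/-!
# Stub `stub_insideFreeSchurHadamard` of line `Sketch` (card `pauli-freezing`)
(crux `Summit.QuantumFields.QCD.Theses.QuarksAsStableAction.StableActionBridge`,
item stmt-QuantumFields-9737, route route-QuantumFields-QuarksAsStableAction)

## Summary

Schur-complement-through-the-outside-block Hadamard bound for a two-block complex matrix
`[[A, B], [C, D]]` with invertible bottom-right block `D` (the small-field / outside block):

`‖det [[A, B], [C, D]]‖ ≤ ‖det D‖ · ∏ᵢ √(∑ⱼ ‖(A − B D⁻¹ C)ᵢⱼ‖²)`.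

Proof.  From `IsUnit D.det` we get `Invertible D` (`Matrix.invertibleOfIsUnitDet`), so the Schur
complement formula `det [[A, B], [C, D]] = det D · det (A − B ⅟D C)` (`Matrix.det_fromBlocks₂₂`,
with `⅟D = D⁻¹` by `Matrix.invOf_eq_nonsing_inv`) applies.  Taking norms, it remains to bound
`‖det X‖` for the Schur complement `X := A − B D⁻¹ C` by the product of the Euclidean row norms,
which is Hadamard's inequality `‖det X‖² ≤ ∏ᵢ ∑ⱼ ‖Xᵢⱼ‖²`
(`Literature.Analysis.Matrix.norm_det_sq_le_prod_sum_sq`) after taking square roots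
(`Real.le_sqrt_of_sq_le`, `Real.sqrt_prod`).
-/

namespace Summit.QuantumFields.QCD.Cruxes.StableActionBridge.Sketch

/-- **Hadamard bound for a square complex matrix, row-norm form.**
`‖det X‖ ≤ ∏ᵢ √(∑ⱼ ‖Xᵢⱼ‖²)` — the square root of Hadamard's inequality. -/
private theorem norm_det_le_prod_sqrt_sum_sq {m : Type} [Fintype m] [DecidableEq m]
    (X : Matrix m m ℂ) : ‖X.det‖ ≤ ∏ i, Real.sqrt (∑ j, ‖X i j‖ ^ 2) := by
  rw [← Real.sqrt_prod _ (fun i _ => Finset.sum_nonneg fun j _ => by positivity)]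
  exact Real.le_sqrt_of_sq_le (Literature.Analysis.Matrix.norm_det_sq_le_prod_sum_sq X)

/-- **Inside-free Schur–Hadamard bound** (card `pauli-freezing`, first lemma).  For a two-block
complex matrix `[[A, B], [C, D]]` whose bottom-right (outside) block `D` has invertible determinant,
`‖det [[A, B], [C, D]]‖ ≤ ‖det D‖ · ∏ᵢ √(∑ⱼ ‖(A − B D⁻¹ C)ᵢⱼ‖²)`: the Schur complement is taken
through the outside block `D`, and the inside factor is bounded by one Hadamard inequality. -/
theorem stub_insideFreeSchurHadamard :
    ∀ (m n : Type) [Fintype m] [Fintype n] [DecidableEq m] [DecidableEq n]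
      (A : Matrix m m ℂ) (B : Matrix m n ℂ) (C : Matrix n m ℂ) (D : Matrix n n ℂ), IsUnit D.det →
        ‖(Matrix.fromBlocks A B C D).det‖ ≤
          ‖D.det‖ * ∏ i, Real.sqrt (∑ j, ‖(A - B * D⁻¹ * C) i j‖ ^ 2) := by
  intro m n _ _ _ _ A B C D hD
  letI : Invertible D := D.invertibleOfIsUnitDet hD
  rw [Matrix.det_fromBlocks₂₂, Matrix.invOf_eq_nonsing_inv, norm_mul]
  exact mul_le_mul_of_nonneg_left (norm_det_le_prod_sqrt_sum_sq _) (norm_nonneg _)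

end Summit.QuantumFields.QCD.Cruxes.StableActionBridge.Sketch
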